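import Literature.Analysis.Hypoelliptic.AmplitudeOperator
import Literature.Analysis.Hypoelliptic.HormanderProof
import Mathlib.Analysis.Calculus.BumpFunction.InnerProduct
import HarnessLib

/-!
# The crude parametrix of an elliptic operator as an amplitude of order `-k`

Analysis/Hypoelliptic support file serving the discharge of the named fact
`Literature.Analysis.Distribution.Folland1995_cor634` (Folland 1995, Cor. (6.34)), continuing
`AmplitudeOperator.lean`.

For the transposed operator `ᵗL = ∑_{w ∈ S} ᵗX_w (b_w ·)` (smooth vector fields `X_i` and
coefficients `b_w` on the inner product space `V`, all words of length `≤ k`) with twisted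
principal symbol `σ̃ = twSymb` (`Amplitude.lean`), **elliptic of order `k` on the support of a
cutoff `χ`** (`σ̃(x, ξ) ≠ 0` for `x ∈ tsupport χ`, `ξ ≠ 0`), we construct the amplitude

  `q(x, ξ) = χ(x) (1 - θ(ξ)) / σ̃(x, ξ)`   (`θ` a bump `= 1` on the unit ball)

and prove that it is an amplitude of order `-k` (`isAmp_parQ`: joint smoothness; the
`x`-derivative bounds `‖D_x^N q(·, ξ)‖ ≤ C_N ⟨ξ⟩^{-k}` by homogeneity — `σ̃(x, ξ) = ‖ξ‖^k σ̃(x, ξ/‖ξ‖)`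
— and the Faà di Bruno bound for `1/σ̃(·, ω)` uniformly over the unit sphere) and the
**parametrix identity** (`exists_parametrix`):

  `twOp q = χ + r`, `r` an amplitude of order `-1`,

i.e. (with `AmplitudeOperator.opC_ampOp`) `ᵗL (Op(q) φ) = χ φ + Op(r) φ`: a right inverse of
`ᵗL` modulo an operator gaining one derivative — the only pseudo-differential input of the
duality bootstrap proving elliptic regularity.

## References

* G. B. Folland, *Introduction to Partial Differential Equations*, 2nd ed. (1995), Ch. 6 §C
  ((6.27): `|∑ a_α(x) ξ^α| ≥ A|ξ|^k` uniformly on compact sets).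
* M. E. Taylor, *Pseudodifferential Operators* (1981), Ch. III §1 (elliptic parametrices;
  folklore).
-/

noncomputable section

open MeasureTheory Set Filter Function TopologicalSpace Real Metric
open scoped Topology InnerProductSpace BigOperators ContDiff ComplexConjugate FourierTransform ENNReal

namespace Literature.Analysis.Hypoelliptic

open Literature.Analysis.Distribution

variable {V : Type*} [NormedAddCommGroup V] [InnerProductSpace ℝ V] [FiniteDimensional ℝ V]
variable {ι : Type*} {Y : ι → V → V} {S : Finset (List ι)} {b : List ι → V → ℝ} {k : ℕ}

/-! ### Smoothness, continuity and homogeneity of the twisted principal symbol -/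

section Symbol

omit [FiniteDimensional ℝ V]

/-- `λ_Z` is jointly smooth. [folklore] -/
theorem contDiff_lam {Z : V → V} (hZ : ContDiff ℝ ∞ Z) : ContDiff ℝ ∞ (uncurry (lam Z)) := by
  have h1 : ContDiff ℝ ∞ fun p : V × V => ((⟪p.2, Z p.1⟫_ℝ : ℝ) : ℂ) :=
    Complex.ofRealCLM.contDiff.comp (contDiff_snd.inner ℝ (hZ.comp contDiff_fst))
  exact contDiff_const.mul h1

/-- `Λ_w` is jointly smooth. [folklore] -/
theorem contDiff_Lam (hY : ∀ i, ContDiff ℝ ∞ (Y i)) : ∀ w : List ι, ContDiff ℝ ∞ (uncurry (Lam Y w))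
  | [] => by
    have e : uncurry (Lam Y ([] : List ι)) = fun _ : V × V => (1 : ℂ) := by ext ⟨x, ξ⟩; simp [uncurry]
    rw [e]; exact contDiff_const
  | i :: w => by
    have ih := contDiff_Lam hY w
    have e : uncurry (Lam Y (i :: w)) = fun p : V × V => uncurry (lam (Y i)) p * uncurry (Lam Y w) p := by
      ext ⟨x, ξ⟩; simp [uncurry]
    rw [e]; exact (contDiff_lam (hY i)).mul ih

/-- `σ̃` is jointly smooth. [folklore] -/
theorem contDiff_twSymb (hY : ∀ i, ContDiff ℝ ∞ (Y i)) (hb : ∀ w, ContDiff ℝ ∞ (b w)) (S : Finset (List ι)) (k : ℕ) :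
    ContDiff ℝ ∞ (uncurry (twSymb Y S b k)) := by
  have e : uncurry (twSymb Y S b k) = fun p : V × V =>
      ∑ w ∈ S with w.length = k, (b w p.1 : ℂ) * uncurry (Lam Y w) p := by
    ext ⟨x, ξ⟩; simp [uncurry, twSymb]
  rw [e]
  exact ContDiff.sum fun w _ => (Complex.ofRealCLM.contDiff.comp ((hb w).comp contDiff_fst)).mul (contDiff_Lam hY w)

/-- Homogeneity of `λ_Z`. [folklore] -/
theorem lam_smul (Z : V → V) (x ξ : V) (t : ℝ) : lam Z x (t • ξ) = t * lam Z x ξ := by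
  simp only [lam, real_inner_smul_left]; push_cast; ring

/-- Homogeneity of `Λ_w` (degree `|w|`). [folklore] -/
theorem Lam_smul (Y : ι → V → V) (x ξ : V) (t : ℝ) : ∀ w : List ι,
    Lam Y w x (t • ξ) = (t : ℂ) ^ w.length * Lam Y w x ξ
  | [] => by simp
  | i :: w => by
    rw [Lam_cons, Lam_cons, Lam_smul Y x ξ t w, lam_smul, List.length_cons, pow_succ]; ring

/-- **Homogeneity of the twisted principal symbol** (degree `k`). [folklore] -/
theorem twSymb_smul (Y : ι → V → V) (S : Finset (List ι)) (b : List ι → V → ℝ) (k : ℕ) (x ξ : V) (t : ℝ) :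
    twSymb Y S b k x (t • ξ) = (t : ℂ) ^ k * twSymb Y S b k x ξ := by
  simp only [twSymb, Finset.mul_sum]
  refine Finset.sum_congr rfl fun w hw => ?_
  rw [Lam_smul, (Finset.mem_filter.1 hw).2]; ring

/-- `‖σ̃(x, ξ)‖ = ‖ξ‖^k ‖σ̃(x, ξ/‖ξ‖)‖`. [folklore] -/
theorem norm_twSymb_eq (Y : ι → V → V) (S : Finset (List ι)) (b : List ι → V → ℝ) (k : ℕ) (x : V) {ξ : V} (hξ : ξ ≠ 0) :
    twSymb Y S b k x ξ = ((‖ξ‖ ^ k : ℝ) : ℂ) * twSymb Y S b k x (‖ξ‖⁻¹ • ξ) := by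
  have h : ξ = ‖ξ‖ • (‖ξ‖⁻¹ • ξ) := by
    rw [smul_smul, mul_inv_cancel₀ (norm_ne_zero_iff.2 hξ), one_smul]
  conv_lhs => rw [h]
  rw [twSymb_smul]; push_cast; ring

end Symbol

/-! ### A cutoff times the twisted symbol is an amplitude of order `k` -/

omit [FiniteDimensional ℝ V] in
/-- `χ₀ · σ̃` is an amplitude of order `k` for a compactly supported cutoff `χ₀`. [folklore] -/
theorem isAmp_cutoff_twSymb (hY : ∀ i, ContDiff ℝ ∞ (Y i)) (hb : ∀ w, ContDiff ℝ ∞ (b w)) (S : Finset (List ι))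
    (k : ℕ) {χ₀ : V → ℝ} (hχ₀ : ContDiff ℝ ∞ χ₀) (hχ₀c : HasCompactSupport χ₀) :
    IsAmp (fun x ξ => (χ₀ x : ℂ) * twSymb Y S b k x ξ) k := by
  have e : (fun x ξ => (χ₀ x : ℂ) * twSymb Y S b k x ξ) =
      fun x ξ => ∑ w ∈ S with w.length = k, Lam Y w x ξ * ((χ₀ x * b w x : ℝ) : ℂ) := by
    ext x ξ; simp only [twSymb, Finset.mul_sum]; push_cast
    exact Finset.sum_congr rfl fun w _ => by ring
  rw [e]
  refine IsAmp.sum _ fun w hw => ?_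
  have h0 : IsAmp (fun x (_ : V) => ((χ₀ x * b w x : ℝ) : ℂ)) 0 :=
    IsAmp.of_fun_real (hχ₀.mul (hb w)) hχ₀c.mul_right
  have h := isAmp_mul_Lam hY w h0
  rw [(Finset.mem_filter.1 hw).2, zero_add] at h
  exact h

/-! ### The uniform lower bound from ellipticity -/

/-- **Folland (6.27)**: on a compact set on which `σ̃(x, ξ) ≠ 0` for `ξ ≠ 0`, there is `A > 0`
with `A ‖ξ‖^k ≤ ‖σ̃(x, ξ)‖` (minimum over the unit sphere and homogeneity).
[cite: Folland2020, Ch. 6 §C, (6.27)] -/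
theorem exists_twSymb_lower_bound [Nontrivial V] (hY : ∀ i, ContDiff ℝ ∞ (Y i)) (hb : ∀ w, ContDiff ℝ ∞ (b w))
    {K : Set V} (hK : IsCompact K) (hell : ∀ x ∈ K, ∀ ξ : V, ξ ≠ 0 → twSymb Y S b k x ξ ≠ 0) :
    ∃ A : ℝ, 0 < A ∧ ∀ x ∈ K, ∀ ξ : V, ξ ≠ 0 → A * ‖ξ‖ ^ k ≤ ‖twSymb Y S b k x ξ‖ := by
  by_cases hKe : K = ∅
  · exact ⟨1, one_pos, fun x hx => by simp [hKe] at hx⟩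
  have hne : (K ×ˢ sphere (0 : V) 1).Nonempty :=
    (Set.nonempty_iff_ne_empty.2 hKe).prod ((NormedSpace.sphere_nonempty).2 zero_le_one)
  have hc : Continuous fun p : V × V => ‖twSymb Y S b k p.1 p.2‖ := (contDiff_twSymb hY hb S k).continuous.norm
  obtain ⟨p₀, hp₀, hmin⟩ := (hK.prod (isCompact_sphere (0 : V) 1)).exists_isMinOn hne hc.continuousOn
  have hp₀2 : p₀.2 ≠ 0 := by
    have : ‖p₀.2‖ = 1 := by simpa using hp₀.2
    intro h; rw [h, norm_zero] at this; exact zero_ne_one this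
  set A : ℝ := ‖twSymb Y S b k p₀.1 p₀.2‖ with hA
  have hApos : 0 < A := norm_pos_iff.2 (hell p₀.1 hp₀.1 p₀.2 hp₀2)
  refine ⟨A, hApos, fun x hx ξ hξ => ?_⟩
  set v0 : V := ‖ξ‖⁻¹ • ξ with hv0
  have hv0s : v0 ∈ sphere (0 : V) 1 := by
    rw [mem_sphere_zero_iff_norm, hv0, norm_smul, norm_inv, norm_norm, inv_mul_cancel₀ (norm_ne_zero_iff.2 hξ)]
  have h1 : A ≤ ‖twSymb Y S b k x v0‖ := hmin (show (x, v0) ∈ K ×ˢ sphere (0 : V) 1 from ⟨hx, hv0s⟩)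
  rw [norm_twSymb_eq Y S b k x hξ, norm_mul, Complex.norm_real, Real.norm_of_nonneg (pow_nonneg (norm_nonneg ξ) k),
    mul_comm (‖ξ‖ ^ k)]
  exact mul_le_mul_of_nonneg_right h1 (pow_nonneg (norm_nonneg ξ) k)

/-! ### The parametrix amplitude -/

/-- The bump `θ` in `ξ`: `= 1` on the closed unit ball, supported in the ball of radius `2`.
[folklore] -/
def bumpθ (V : Type*) [NormedAddCommGroup V] [InnerProductSpace ℝ V] : ContDiffBump (0 : V) :=
  ⟨1, 2, one_pos, one_lt_two⟩

/-- **The parametrix amplitude** `q(x, ξ) = χ(x) (1 - θ(ξ)) / σ̃(x, ξ)`. [folklore] -/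
def parQ (Y : ι → V → V) (S : Finset (List ι)) (b : List ι → V → ℝ) (k : ℕ) (χ : V → ℝ) (x ξ : V) : ℂ :=
  (χ x : ℂ) * (((1 : ℝ) - bumpθ V ξ : ℝ) : ℂ) * (twSymb Y S b k x ξ)⁻¹

/-- `θ = 1` on the closed unit ball. [folklore] -/
theorem bumpθ_eq_one {ξ : V} (hξ : ‖ξ‖ ≤ 1) : bumpθ V ξ = 1 :=
  (bumpθ V).one_of_mem_closedBall (mem_closedBall_zero_iff.2 hξ)

/-- `θ = 0` outside the ball of radius `2`. [folklore] -/
theorem bumpθ_eq_zero {ξ : V} (hξ : 2 ≤ ‖ξ‖) : bumpθ V ξ = 0 :=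
  (bumpθ V).zero_of_le_dist (by change (2 : ℝ) ≤ dist ξ 0; rwa [dist_zero_right])

/-- `0 ≤ 1 - θ ≤ 1`. [folklore] -/
theorem abs_one_sub_bumpθ_le (ξ : V) : |(1 : ℝ) - bumpθ V ξ| ≤ 1 := by
  have h1 := (bumpθ V).nonneg' ξ
  have h2 : bumpθ V ξ ≤ 1 := (bumpθ V).le_one
  rw [abs_le]; constructor <;> linarith

/-- The slices `q(·, ξ)` are supported in `tsupport χ`. [folklore] -/
theorem tsupport_parQ_subset (χ : V → ℝ) (ξ : V) :
    tsupport (fun x => parQ Y S b k χ x ξ) ⊆ tsupport χ := by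
  unfold parQ
  refine (tsupport_mul_subset_left.trans tsupport_mul_subset_left).trans ?_
  exact closure_mono fun x hx => by simpa using hx

/-- `q(·, ξ) = 0` for `‖ξ‖ ≤ 1`. [folklore] -/
theorem parQ_eq_zero_of_norm_le (χ : V → ℝ) (x : V) {ξ : V} (hξ : ‖ξ‖ ≤ 1) : parQ Y S b k χ x ξ = 0 := by
  simp [parQ, bumpθ_eq_one hξ]

/-- **`q` is jointly smooth** (it vanishes near `ξ = 0` and near `x ∉ tsupport χ`, and `σ̃ ≠ 0`
elsewhere). [folklore] -/
theorem contDiff_parQ (hY : ∀ i, ContDiff ℝ ∞ (Y i)) (hb : ∀ w, ContDiff ℝ ∞ (b w)) {χ : V → ℝ} (hχ : ContDiff ℝ ∞ χ)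
    (hell : ∀ x ∈ tsupport χ, ∀ ξ : V, ξ ≠ 0 → twSymb Y S b k x ξ ≠ 0) :
    ContDiff ℝ ∞ (uncurry (parQ Y S b k χ)) := by
  refine contDiff_iff_contDiffAt.2 fun p => ?_
  by_cases hx : p.1 ∈ tsupport χ
  · by_cases hξ : p.2 = 0
    · -- near `p`, `θ = 1`, so `q = 0`
      have hU : {r : V × V | ‖r.2‖ < 1} ∈ 𝓝 p := by
        refine (isOpen_lt (continuous_norm.comp continuous_snd) continuous_const).mem_nhds ?_
        show ‖p.2‖ < 1; rw [hξ, norm_zero]; exact one_pos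
      refine (contDiffAt_const (c := (0 : ℂ))).congr_of_eventuallyEq ?_
      filter_upwards [hU] with r hr
      exact parQ_eq_zero_of_norm_le χ r.1 (le_of_lt hr)
    · have hne := hell p.1 hx p.2 hξ
      have h1 : ContDiffAt ℝ ∞ (fun r : V × V => (χ r.1 : ℂ)) p :=
        (Complex.ofRealCLM.contDiff.comp (hχ.comp contDiff_fst)).contDiffAt
      have h2 : ContDiffAt ℝ ∞ (fun r : V × V => (((1 : ℝ) - bumpθ V r.2 : ℝ) : ℂ)) p :=
        (Complex.ofRealCLM.contDiff.comp (contDiff_const.sub ((bumpθ V).contDiff.comp contDiff_snd))).contDiffAt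
      have h3 : ContDiffAt ℝ ∞ (fun r : V × V => (twSymb Y S b k r.1 r.2)⁻¹) p :=
        (contDiffAt_inv ℝ hne).comp p (contDiff_twSymb hY hb S k).contDiffAt
      exact (h1.mul h2).mul h3
  · -- near `p`, `χ = 0`, so `q = 0`
    have hU : {r : V × V | r.1 ∈ (tsupport χ)ᶜ} ∈ 𝓝 p :=
      ((isClosed_tsupport χ).isOpen_compl.preimage continuous_fst).mem_nhds hx
    refine (contDiffAt_const (c := (0 : ℂ))).congr_of_eventuallyEq ?_
    filter_upwards [hU] with r hr
    have : χ r.1 = 0 := image_eq_zero_of_notMem_tsupport hr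
    simp [uncurry, parQ, this]

omit [InnerProductSpace ℝ V] [FiniteDimensional ℝ V] in
/-- `(‖ξ‖^k)⁻¹ ≤ 2^{k/2} ⟨ξ⟩^{-k}` for `‖ξ‖ ≥ 1`. [folklore] -/
theorem inv_norm_pow_le_bw {ξ : V} (hξ : 1 ≤ ‖ξ‖) (k : ℕ) : (‖ξ‖ ^ k)⁻¹ ≤ 2 ^ ((k : ℝ) / 2) * bw (-k) ξ := by
  have hpos : 0 < ‖ξ‖ ^ k := pow_pos (by linarith) k
  have h1 : bw k ξ ≤ 2 ^ ((k : ℝ) / 2) * ‖ξ‖ ^ k := by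
    have hle : 1 + ‖ξ‖ ^ 2 ≤ 2 * ‖ξ‖ ^ 2 := by nlinarith
    calc bw k ξ = (1 + ‖ξ‖ ^ 2) ^ ((k : ℝ) / 2) := rfl
      _ ≤ (2 * ‖ξ‖ ^ 2) ^ ((k : ℝ) / 2) := Real.rpow_le_rpow (by positivity) hle (by positivity)
      _ = 2 ^ ((k : ℝ) / 2) * (‖ξ‖ ^ 2) ^ ((k : ℝ) / 2) := Real.mul_rpow (by norm_num) (by positivity)
      _ = 2 ^ ((k : ℝ) / 2) * ‖ξ‖ ^ k := by
          congr 1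
          rw [← Real.rpow_natCast ‖ξ‖ 2, ← Real.rpow_mul (norm_nonneg ξ), ← Real.rpow_natCast]
          congr 1; push_cast; ring
  have h2 : (‖ξ‖ ^ k)⁻¹ = bw (-k) ξ * (bw k ξ * (‖ξ‖ ^ k)⁻¹) := by
    rw [← mul_assoc, mul_comm (bw (-(k : ℝ)) ξ), bw_mul_bw_neg, one_mul]
  rw [h2]
  calc bw (-k) ξ * (bw k ξ * (‖ξ‖ ^ k)⁻¹) ≤ bw (-k) ξ * (2 ^ ((k : ℝ) / 2) * ‖ξ‖ ^ k * (‖ξ‖ ^ k)⁻¹) :=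
        mul_le_mul_of_nonneg_left (mul_le_mul_of_nonneg_right h1 (inv_nonneg.2 hpos.le)) (bw_nonneg _ _)
    _ = 2 ^ ((k : ℝ) / 2) * bw (-k) ξ := by rw [mul_assoc, mul_inv_cancel₀ hpos.ne', mul_one, mul_comm]

/-- **The `x`-derivative bounds of the parametrix amplitude**: `‖D_x^N q(·, ξ)‖ ≤ C_N ⟨ξ⟩^{-k}`.
Proof: for `‖ξ‖ ≤ 1` the slice vanishes; for `‖ξ‖ ≥ 1` write `q(·, ξ) = (1-θ(ξ))‖ξ‖^{-k} · χ/σ̃(·, ω)`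
with `ω = ξ/‖ξ‖`, and bound the derivatives of `χ · (1/σ̃(·, ω))` uniformly in `ω` on the unit
sphere by the Leibniz and Faà di Bruno bounds (derivatives of `z ↦ z⁻¹` on the compact set
`σ̃(tsupport χ × sphere)`, derivatives of `σ̃(·, ω)` from the amplitude `χ₀ σ̃` of order `k`).
[folklore] -/
theorem parQ_bound [Nontrivial V] (hY : ∀ i, ContDiff ℝ ∞ (Y i)) (hb : ∀ w, ContDiff ℝ ∞ (b w))
    {χ : V → ℝ} (hχ : ContDiff ℝ ∞ χ) (hχc : HasCompactSupport χ)
    (hell : ∀ x ∈ tsupport χ, ∀ ξ : V, ξ ≠ 0 → twSymb Y S b k x ξ ≠ 0) (N : ℕ) :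
    ∃ C : ℝ, 0 ≤ C ∧ ∀ x ξ, ‖iteratedFDeriv ℝ N (fun y => parQ Y S b k χ y ξ) x‖ ≤ C * bw (-k) ξ := by
  set K : Set V := tsupport χ with hKdef
  have hK : IsCompact K := hχc
  set σ : V → V → ℂ := twSymb Y S b k with hσ
  have hσs : ContDiff ℝ ∞ (uncurry σ) := contDiff_twSymb hY hb S k
  -- a cutoff `χ₀ = 1` near `K`; `χ₀ σ` is an amplitude of order `k`
  obtain ⟨χ₀, hχ₀s, hχ₀c, -, hχ₀1⟩ := exists_bump (hK.cthickening (r := 1)) isOpen_univ (subset_univ _)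
  have hU₁ : ∀ x ∈ thickening 1 K, χ₀ x = 1 := fun x hx => hχ₀1 x (thickening_subset_cthickening 1 K hx)
  have hKU₁ : K ⊆ thickening 1 K := self_subset_thickening one_pos K
  have hSig := isAmp_cutoff_twSymb hY hb S k hχ₀s hχ₀c
  choose Cs hCs0 hCs using hSig.bound
  -- uniform bounds for the derivatives of `σ(·, v0)` on `K`, `‖v0‖ = 1`
  set Ds : ℕ → ℝ := fun i => Cs i * bw k (0 : V) * 2 ^ ((k : ℝ) / 2) + Cs i * 2 ^ ((k : ℝ) / 2) with hDs
  have hbw1 : ∀ v0 : V, ‖v0‖ = 1 → bw k v0 ≤ 2 ^ ((k : ℝ) / 2) := fun v0 hv0 => by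
    have h := inv_norm_pow_le_bw (le_of_eq hv0.symm) k
    rw [hv0, one_pow, inv_one] at h
    have h' : bw k v0 = bw k v0 * (2 ^ ((k : ℝ) / 2) * bw (-k) v0) / (2 ^ ((k : ℝ) / 2) * bw (-k) v0) := by
      rw [mul_div_assoc, div_self (by have := bw_pos (-(k : ℝ)) v0; positivity), mul_one]
    calc bw k v0 ≤ bw k v0 * (2 ^ ((k : ℝ) / 2) * bw (-k) v0) := le_mul_of_one_le_right (bw_nonneg _ _) h
      _ = 2 ^ ((k : ℝ) / 2) * (bw k v0 * bw (-k) v0) := by ring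
      _ = 2 ^ ((k : ℝ) / 2) := by rw [bw_mul_bw_neg, mul_one]
  have hDsb : ∀ i (v0 : V), ‖v0‖ = 1 → ∀ x ∈ K, ‖iteratedFDeriv ℝ i (fun y => σ y v0) x‖ ≤ Cs i * 2 ^ ((k : ℝ) / 2) := by
    intro i v0 hv0 x hx
    have hev : (fun y => (χ₀ y : ℂ) * σ y v0) =ᶠ[𝓝 x] fun y => σ y v0 := by
      filter_upwards [isOpen_thickening.mem_nhds (hKU₁ hx)] with y hy
      rw [hU₁ y hy]; simp
    rw [← (hev.iteratedFDeriv ℝ i).eq_of_nhds]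
    exact (hCs i x v0).trans (mul_le_mul_of_nonneg_left (hbw1 v0 hv0) (hCs0 i))
  -- bounds for the derivatives of `z ↦ z⁻¹` on the compact set `σ(K × sphere)`
  set t : Set ℂ := {z | z ≠ 0} with ht
  have hto : IsOpen t := isOpen_compl_singleton
  have htu : UniqueDiffOn ℝ t := hto.uniqueDiffOn
  have hinv : ContDiffOn ℝ ∞ (Inv.inv : ℂ → ℂ) t := by
    have := contDiffOn_inv ℝ (𝕜' := ℂ) (n := ∞); simpa [ht, Set.compl_def] using this
  set Z : Set ℂ := (uncurry σ) '' (K ×ˢ sphere (0 : V) 1) with hZ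
  have hZc : IsCompact Z := (hK.prod (isCompact_sphere (0 : V) 1)).image hσs.continuous
  have hZt : Z ⊆ t := by
    rintro z ⟨⟨x, v0⟩, ⟨hx, hv0⟩, rfl⟩
    have hv00 : v0 ≠ 0 := by
      intro h; rw [mem_sphere_zero_iff_norm, h, norm_zero] at hv0; exact zero_ne_one hv0
    exact hell x hx v0 hv00
  have hCi : ∀ i : ℕ, ∃ Ci : ℝ, 0 ≤ Ci ∧ ∀ z ∈ Z, ‖iteratedFDerivWithin ℝ i (Inv.inv : ℂ → ℂ) t z‖ ≤ Ci := by
    intro i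
    have hcont : ContinuousOn (iteratedFDerivWithin ℝ i (Inv.inv : ℂ → ℂ) t) Z :=
      (hinv.continuousOn_iteratedFDerivWithin (mod_cast le_top) htu).mono hZt
    obtain ⟨Ci, hCi⟩ := hZc.exists_bound_of_continuousOn hcont
    exact ⟨max Ci 0, le_max_right _ _, fun z hz => (hCi z hz).trans (le_max_left _ _)⟩
  choose Ci hCi0 hCi using hCi
  set Cinv : ℝ := ∑ i ∈ Finset.range (N + 1), Ci i with hCinv
  have hCinv0 : 0 ≤ Cinv := Finset.sum_nonneg fun i _ => hCi0 i
  have hCinvi : ∀ i ≤ N, Ci i ≤ Cinv := fun i hi =>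
    Finset.single_le_sum (f := Ci) (fun j _ => hCi0 j) (Finset.mem_range.2 (Nat.lt_succ_of_le hi))
  -- the constant `D ≥ 1` dominating the derivatives of `σ(·, v0)`
  set D : ℝ := 1 + ∑ i ∈ Finset.range (N + 1), Cs i * 2 ^ ((k : ℝ) / 2) with hD
  have hD1 : 1 ≤ D := by
    have : 0 ≤ ∑ i ∈ Finset.range (N + 1), Cs i * 2 ^ ((k : ℝ) / 2) :=
      Finset.sum_nonneg fun i _ => by have := hCs0 i; positivity
    linarith
  have hDi : ∀ i ≤ N, Cs i * 2 ^ ((k : ℝ) / 2) ≤ D := fun i hi => by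
    have := Finset.single_le_sum (f := fun j => Cs j * 2 ^ ((k : ℝ) / 2))
      (fun j _ => by have := hCs0 j; positivity) (Finset.mem_range.2 (Nat.lt_succ_of_le hi))
    exact this.trans (by rw [hD]; linarith)
  -- derivatives of `χ`
  obtain ⟨Gχ, hGχ0, hGχ⟩ := IsAmp.exists_forall_norm_iteratedFDeriv_le
    (Complex.ofRealCLM.contDiff.comp hχ) hK
  -- the uniform bound `B` for `χ / σ(·, v0)`
  set B : ℝ := ∑ i ∈ Finset.range (N + 1), (N.choose i : ℝ) * Gχ i * (((N - i).factorial : ℝ) * Cinv * D ^ (N - i)) with hB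
  have hB0 : 0 ≤ B := Finset.sum_nonneg fun i _ => by
    have := hGχ0 i; positivity
  refine ⟨2 ^ ((k : ℝ) / 2) * B, by positivity, fun x ξ => ?_⟩
  -- Case `‖ξ‖ ≤ 1`: the slice vanishes
  by_cases hξ1 : ‖ξ‖ ≤ 1
  · have h0 : (fun y => parQ Y S b k χ y ξ) = fun _ => 0 := funext fun y => parQ_eq_zero_of_norm_le χ y hξ1
    rw [h0, iteratedFDeriv_fun_zero, Pi.zero_apply, norm_zero]
    exact mul_nonneg (by positivity) (bw_nonneg _ _)
  rw [not_le] at hξ1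
  have hξ0 : ξ ≠ 0 := by intro h; rw [h, norm_zero] at hξ1; exact absurd hξ1 (by norm_num)
  -- Case `x ∉ K`
  by_cases hxK : x ∉ K
  · rw [IsAmp.iteratedFDeriv_eq_zero (a := parQ Y S b k χ) (fun η => tsupport_parQ_subset χ η) hxK N ξ, norm_zero]
    exact mul_nonneg (by positivity) (bw_nonneg _ _)
  rw [not_not] at hxK
  -- normalise: `q(·, ξ) = c • g`, `g = χ / σ(·, v0)`
  set v0 : V := ‖ξ‖⁻¹ • ξ with hv0
  have hv01 : ‖v0‖ = 1 := by
    rw [hv0, norm_smul, norm_inv, norm_norm, inv_mul_cancel₀ (norm_ne_zero_iff.2 hξ0)]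
  have hv00 : v0 ≠ 0 := by intro h; rw [h, norm_zero] at hv01; exact zero_ne_one hv01
  set g : V → ℂ := fun y => (χ y : ℂ) * (σ y v0)⁻¹ with hg
  set c : ℝ := ((1 : ℝ) - bumpθ V ξ) * (‖ξ‖ ^ k)⁻¹ with hc
  have hslice : (fun y => parQ Y S b k χ y ξ) = c • g := by
    ext y
    simp only [hg, hc, Pi.smul_apply, Complex.real_smul, parQ]
    rw [hσ] ; rw [norm_twSymb_eq Y S b k y hξ0, mul_inv]
    push_cast; ring
  -- the open set where `σ(·, v0) ≠ 0`
  set s : Set V := {y | σ y v0 ≠ 0} with hs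
  have hso : IsOpen s := isOpen_compl_singleton.preimage (hσs.continuous.comp (Continuous.prodMk_left v0))
  have hKs : K ⊆ s := fun y hy => hell y hy v0 hv00
  have hxs : x ∈ s := hKs hxK
  have hσv0 : ContDiff ℝ ∞ fun y => σ y v0 := hσs.comp (contDiff_prodMk_left v0)
  have hinvσ : ContDiffOn ℝ ∞ (fun y => (σ y v0)⁻¹) s :=
    hinv.comp hσv0.contDiffOn fun y hy => hy
  have hχC : ContDiff ℝ ∞ fun y => (χ y : ℂ) := Complex.ofRealCLM.contDiff.comp hχ
  -- `g` is smooth at `x`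
  have hgx : ContDiffAt ℝ ∞ g x := hχC.contDiffAt.mul (hinvσ.contDiffAt (hso.mem_nhds hxs))
  -- Faà di Bruno bound for `(σ(·, v0))⁻¹` within `s`
  have hFaa : ∀ j ≤ N, ‖iteratedFDerivWithin ℝ j (fun y => (σ y v0)⁻¹) s x‖ ≤ (j.factorial : ℝ) * Cinv * D ^ j := by
    intro j hj
    have h := norm_iteratedFDerivWithin_comp_le (𝕜 := ℝ) (g := (Inv.inv : ℂ → ℂ)) (f := fun y => σ y v0)
      (n := j) (N := (∞ : ℕ∞ω)) (s := s) (t := t) (x := x) hinv hσv0.contDiffOn (mod_cast le_top) htu hso.uniqueDiffOn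
      (fun y hy => hy) hxs (C := Cinv) (D := D)
      (fun i hi => (hCi i _ ⟨(x, v0), ⟨hxK, mem_sphere_zero_iff_norm.2 hv01⟩, rfl⟩).trans (hCinvi i (hi.trans hj)))
      (fun i hi1 hi => by
        rw [iteratedFDerivWithin_of_isOpen i hso hxs]
        calc ‖iteratedFDeriv ℝ i (fun y => σ y v0) x‖ ≤ Cs i * 2 ^ ((k : ℝ) / 2) := hDsb i v0 hv01 x hxK
          _ ≤ D := hDi i (hi.trans hj)
          _ ≤ D ^ i := le_self_pow₀ hD1 (by omega))
    exact h
  -- Leibniz within `s`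
  have hLeib := norm_iteratedFDerivWithin_mul_le (𝕜 := ℝ) hχC.contDiffOn hinvσ hso.uniqueDiffOn hxs (n := N)
    (mod_cast le_top)
  have hgN : ‖iteratedFDeriv ℝ N g x‖ ≤ B := by
    rw [← iteratedFDerivWithin_of_isOpen N hso hxs]
    refine hLeib.trans ?_
    rw [hB]
    refine Finset.sum_le_sum fun i hi => ?_
    have hiN : i ≤ N := Nat.lt_succ_iff.1 (Finset.mem_range.1 hi)
    have h1 : ‖iteratedFDerivWithin ℝ i (fun y => (χ y : ℂ)) s x‖ ≤ Gχ i := by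
      rw [iteratedFDerivWithin_of_isOpen i hso hxs]; exact hGχ i x hxK
    have h2 := hFaa (N - i) (Nat.sub_le N i)
    have := hGχ0 i
    calc (N.choose i : ℝ) * ‖iteratedFDerivWithin ℝ i (fun y => (χ y : ℂ)) s x‖ *
          ‖iteratedFDerivWithin ℝ (N - i) (fun y => (σ y v0)⁻¹) s x‖
        ≤ (N.choose i : ℝ) * Gχ i * (((N - i).factorial : ℝ) * Cinv * D ^ (N - i)) :=
          mul_le_mul (mul_le_mul_of_nonneg_left h1 (Nat.cast_nonneg _)) h2 (norm_nonneg _) (by positivity)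
      _ = _ := by ring
  -- assemble
  have hcle : |c| ≤ 2 ^ ((k : ℝ) / 2) * bw (-k) ξ := by
    rw [hc, abs_mul, abs_of_nonneg (inv_nonneg.2 (pow_nonneg (norm_nonneg ξ) k))]
    calc |(1 : ℝ) - bumpθ V ξ| * (‖ξ‖ ^ k)⁻¹ ≤ 1 * (‖ξ‖ ^ k)⁻¹ :=
          mul_le_mul_of_nonneg_right (abs_one_sub_bumpθ_le ξ) (inv_nonneg.2 (pow_nonneg (norm_nonneg ξ) k))
      _ ≤ 2 ^ ((k : ℝ) / 2) * bw (-k) ξ := by rw [one_mul]; exact inv_norm_pow_le_bw hξ1.le k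
  rw [hslice, iteratedFDeriv_const_smul_apply (hgx.of_le (mod_cast le_top)), norm_smul, Real.norm_eq_abs]
  calc |c| * ‖iteratedFDeriv ℝ N g x‖ ≤ (2 ^ ((k : ℝ) / 2) * bw (-k) ξ) * B :=
        mul_le_mul hcle hgN (norm_nonneg _) (mul_nonneg (by positivity) (bw_nonneg _ _))
    _ = 2 ^ ((k : ℝ) / 2) * B * bw (-k) ξ := by ring

/-- **The parametrix amplitude is an amplitude of order `-k`.** [folklore] -/
theorem isAmp_parQ [Nontrivial V] (hY : ∀ i, ContDiff ℝ ∞ (Y i)) (hb : ∀ w, ContDiff ℝ ∞ (b w))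
    {χ : V → ℝ} (hχ : ContDiff ℝ ∞ χ) (hχc : HasCompactSupport χ)
    (hell : ∀ x ∈ tsupport χ, ∀ ξ : V, ξ ≠ 0 → twSymb Y S b k x ξ ≠ 0) :
    IsAmp (parQ Y S b k χ) (-k) :=
  ⟨contDiff_parQ hY hb hχ hell, ⟨tsupport χ, hχc, fun ξ => tsupport_parQ_subset χ ξ⟩,
    parQ_bound hY hb hχ hχc hell⟩

/-- `χ(x) θ(ξ)` is an amplitude of order `-1` (indeed of every order). [folklore] -/
theorem isAmp_fun_mul_bumpθ {χ : V → ℝ} (hχ : ContDiff ℝ ∞ χ) (hχc : HasCompactSupport χ) :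
    IsAmp (fun x ξ => (χ x : ℂ) * ((bumpθ V) ξ : ℂ)) (-1) := by
  have h0 := IsAmp.of_fun_real hχ hχc
  refine ⟨?_, ?_, fun N => ?_⟩
  · exact (Complex.ofRealCLM.contDiff.comp (hχ.comp contDiff_fst)).mul
      (Complex.ofRealCLM.contDiff.comp ((bumpθ V).contDiff.comp contDiff_snd))
  · exact ⟨tsupport χ, hχc, fun ξ => (tsupport_mul_subset_left (f := fun x => (χ x : ℂ))).trans
      (closure_mono fun x hx => by simpa using hx)⟩
  · obtain ⟨C, hC0, hC⟩ := h0.bound N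
    refine ⟨C * bw 1 (0 : V) * Real.sqrt 5, by have := bw_nonneg 1 (0 : V); positivity, fun x ξ => ?_⟩
    have e : (fun y => (χ y : ℂ) * ((bumpθ V) ξ : ℂ)) =
        ((bumpθ V) ξ : ℂ) • fun y => (χ y : ℂ) := by ext y; simp [mul_comm]
    rw [e, iteratedFDeriv_const_smul_apply ((h0.slice ξ).contDiffAt.of_le (mod_cast le_top)), norm_smul]
    by_cases hξ : 2 ≤ ‖ξ‖
    · rw [bumpθ_eq_zero hξ]; simp only [Complex.ofReal_zero, norm_zero, zero_mul]
      exact mul_nonneg (by have := bw_nonneg 1 (0 : V); positivity) (bw_nonneg _ _)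
    · rw [not_le] at hξ
      have hθ : ‖(((bumpθ V) ξ : ℝ) : ℂ)‖ ≤ 1 := by
        rw [Complex.norm_real, Real.norm_of_nonneg ((bumpθ V).nonneg' ξ)]; exact (bumpθ V).le_one
      have h1 := hC x ξ
      rw [bw_zero, mul_one] at h1
      -- `1 ≤ √5 ⟨ξ⟩^{-1}` for `‖ξ‖ < 2`
      have hb5 : bw 1 ξ ≤ Real.sqrt 5 := by
        rw [bw_one]; exact Real.sqrt_le_sqrt (by nlinarith [norm_nonneg ξ])
      have h2 : (1 : ℝ) ≤ Real.sqrt 5 * bw (-1) ξ := by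
        have := bw_mul_bw_neg 1 ξ
        calc (1 : ℝ) = bw 1 ξ * bw (-1) ξ := this.symm
          _ ≤ Real.sqrt 5 * bw (-1) ξ := mul_le_mul_of_nonneg_right hb5 (bw_nonneg _ _)
      have h3 : (1 : ℝ) ≤ bw 1 (0 : V) := one_le_bw zero_le_one 0
      calc ‖(((bumpθ V) ξ : ℝ) : ℂ)‖ * ‖iteratedFDeriv ℝ N (fun y => (χ y : ℂ)) x‖ ≤ 1 * C :=
            mul_le_mul hθ h1 (norm_nonneg _) zero_le_one
        _ ≤ C * bw 1 (0 : V) * (Real.sqrt 5 * bw (-1) ξ) := by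
            rw [one_mul]
            calc C = C * 1 * 1 := by ring
              _ ≤ C * bw 1 (0 : V) * (Real.sqrt 5 * bw (-1) ξ) :=
                mul_le_mul (mul_le_mul_of_nonneg_left h3 hC0) h2 zero_le_one (by positivity)
        _ = C * bw 1 (0 : V) * Real.sqrt 5 * bw (-1) ξ := by ring

/-- **The parametrix identity.** For `ᵗL` elliptic of order `k` on the support of the cutoff
`χ` there are amplitudes `q` of order `-k` (supported in `tsupport χ`) and `r` of order `-1`
with `twOp q = χ + r`; by `opC_ampOp`, `ᵗL (Op(q) F) = χ · 𝓕⁻¹F + Op(r) F`. [folklore] -/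
theorem exists_parametrix [Nontrivial V] (hY : ∀ i, ContDiff ℝ ∞ (Y i)) (hb : ∀ w, ContDiff ℝ ∞ (b w))
    (hS : ∀ w ∈ S, w.length ≤ k) {χ : V → ℝ} (hχ : ContDiff ℝ ∞ χ) (hχc : HasCompactSupport χ)
    (hell : ∀ x ∈ tsupport χ, ∀ ξ : V, ξ ≠ 0 → twSymb Y S b k x ξ ≠ 0) :
    ∃ q r : V → V → ℂ, IsAmp q (-k) ∧ IsAmp r (-1) ∧ (∀ ξ, tsupport (fun x => q x ξ) ⊆ tsupport χ) ∧
      twOp Y S b q = fun x ξ => (χ x : ℂ) + r x ξ := by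
  have hq := isAmp_parQ hY hb hχ hχc hell
  obtain ⟨r₁, hr₁, hr₁e⟩ := twOp_principal hY hb hS hq
  have e1 : -(k : ℝ) + k - 1 = -1 := by ring
  rw [e1] at hr₁
  -- `σ̃ q = χ (1 - θ)`
  have hprod : ∀ x ξ, twSymb Y S b k x ξ * parQ Y S b k χ x ξ =
      (χ x : ℂ) * (((1 : ℝ) - bumpθ V ξ : ℝ) : ℂ) := by
    intro x ξ
    by_cases h : twSymb Y S b k x ξ = 0
    · rw [h, zero_mul]
      by_cases hχx : χ x = 0
      · simp [hχx]
      · have hx : x ∈ tsupport χ := subset_tsupport _ (mem_support.2 hχx)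
        by_cases hξ : ξ = 0
        · rw [hξ, bumpθ_eq_one (by simp)]; simp
        · exact absurd h (hell x hx ξ hξ)
    · simp only [parQ]; field_simp
  refine ⟨parQ Y S b k χ, fun x ξ => r₁ x ξ - (χ x : ℂ) * ((bumpθ V) ξ : ℂ), hq,
    hr₁.sub (isAmp_fun_mul_bumpθ hχ hχc), fun ξ => tsupport_parQ_subset χ ξ, ?_⟩
  rw [hr₁e]
  ext x ξ
  simp only
  rw [hprod]
  push_cast; ring

end Literature.Analysis.Hypoelliptic
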